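import Literature.Computability.QuantumComplexity.ForrelationDerivativeTables
import Literature.Computability.QuantumComplexity.ForrelationSignTransport

/-!
# Crux `CubicForrelation.NearExactIsExact` (stmt-QuantumAdvantage-14043), line `direct-sum-amplification` —
stub AUTOCORR: near-exactness forces near-balanced derivatives

NEAR-EXACTNESS FORCES NEAR-BALANCED DERIVATIVES (the first lever of the two-sided almost-bentness analysis of
the crux). For Boolean `f g : {0,1}ⁿ → {0,1}` read through `signOf` (`F = (−1)^f`, `G = (−1)^g`) and every
non-zero shift `t`, the autocorrelation `AC(t) = Σ_y (−1)^{g(y) + g(y ⊕ t)}` of `g` satisfies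

  `|AC(t)| ≤ 2ⁿ · (2 √(2 (1 − Φ(f,g))) + 2 (1 − Φ(f,g)))`       (`tb_autocorr_le_of_forrelation`),

so `Φ(f,g)` close to `1` forces every derivative `D_t g` to be nearly balanced (for `Φ = 1`, `g` is bent and
`AC(t) = 0`).

Proof. WIENER–KHINCHIN (`tb_sum_W_sq_mul_twist`): `Σ_x W_G(x)² (−1)^{x·t} = 2ⁿ · AC(t)` with the tree's
unnormalised Walsh transform `W_G(x) = Σ_y G(y) (−1)^{y·x}` (expand one factor `W_G(x) (−1)^{t·x}` as the
translated character sum `Σ_h G(t ⊕ h) (−1)^{h·x}` (`sum_shift_twist`), multiply out, and sum over `x` with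
character orthogonality `Simon.sum_twist`). THE BOUND (`tb_autocorr_le_real`, for `±1`-valued real `F, G`): put
`c = √(2ⁿ)` and `R = W_G − c F`. From Parseval `Σ W_G² = 4ⁿ` (`sum_W_sq`) and `Σ_x F(x) W_G(x) = 2ⁿ c Φ`
(`fsum_eq_sum_mul_W`, `fsum_signOf_eq`, `sqrt_two_pow_three_mul`) one gets `Σ R² = 2·4ⁿ (1 − Φ)` (so
`1 − Φ ≥ 0`). For `t ≠ 0`, `Σ_x (−1)^{x·t} = 0` kills the `c² F²` term of `W_G² = (cF + R)²`, leaving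
`2ⁿ AC(t) = 2c Σ F R (−1)^{x·t} + Σ R² (−1)^{x·t}`; Cauchy–Schwarz (`Finset.sum_mul_sq_le_sq_mul_sq`) bounds
the first sum by `√(2ⁿ) √(Σ R²) = 2ⁿ c √(2(1 − Φ))` and the second by `Σ R²`, whence
`2ⁿ |AC(t)| ≤ 2·4ⁿ √(2(1 − Φ)) + 2·4ⁿ (1 − Φ)`.

Sources: S. Aaronson, A. Ambainis, *Forrelation*, SIAM J. Comput. 47 (2018), §1.1.1 (`Φ`); R. O'Donnell,
*Analysis of Boolean Functions* (2014), §1.4 (characters, Parseval, Wiener–Khinchin). Everything below is proved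
from Mathlib and the tree (`W`, `fsum`, `sum_W_sq`, `sum_shift_twist`, `fsum_eq_sum_mul_W`, `fsum_signOf_eq`,
`sqrt_two_pow_three_mul`, `Simon.sum_twist`, `sum_twist_left`, `twist_bxor_left`, `signOf_sq`); axioms are the
standard three.
-/

set_option linter.dupNamespace false -- D-0017: single-problem summit ⇒ `QuantumAdvantage.QuantumAdvantage` by design

noncomputable section

namespace Summit.QuantumAdvantage.QuantumAdvantage.Theorems.CubicForrelation.NearExactIsExact

open Finset
open Literature.Computability.QuantumComplexity
open Literature.Computability.QuantumComplexity.BuzetChailloux (bxor zeroVec bxor_comm bxor_eq_zeroVec_iff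
  sum_twist_left signOf_sq)
open Literature.Computability.QuantumComplexity.DerivativeWalsh (W fsum fsum_eq_sum_mul_W sum_shift_twist
  sum_W_sq twist_bxor_left fsum_signOf_eq sqrt_two_pow_three_mul)
open Literature.Computability.QuantumComplexity.Simon (twist_sq twist_eq_one_or sum_twist)

variable {n : ℕ}

/-- **Wiener–Khinchin** for the unnormalised Walsh transform: for every real `G : {0,1}ⁿ → ℝ` and every
shift `t`, `Σ_x W_G(x)² (−1)^{x·t} = 2ⁿ · Σ_y G(y) G(y ⊕ t)` (the Walsh transform of `W_G²` is `2ⁿ` times the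
autocorrelation of `G`). -/
theorem tb_sum_W_sq_mul_twist (G : (Fin n → Bool) → ℝ) (t : Fin n → Bool) :
    ∑ x, W G x ^ 2 * twist x t = (2 : ℝ) ^ n * ∑ y, G y * G (bxor y t) := by
  have e1 : ∀ x : Fin n → Bool, W G x ^ 2 * twist x t =
      ∑ y, ∑ h, G y * G (bxor t h) * twist (bxor y h) x := by
    intro x
    rw [sq, mul_assoc, twist_comm x t, mul_comm (W G x) (twist t x), ← sum_shift_twist G t x, W,
      sum_mul_sum]
    refine sum_congr rfl fun y _ => sum_congr rfl fun h _ => ?_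
    rw [twist_bxor_left]
    ring
  have e2 : ∀ y : Fin n → Bool,
      ∑ x, ∑ h, G y * G (bxor t h) * twist (bxor y h) x = (2 : ℝ) ^ n * (G y * G (bxor y t)) := by
    intro y
    rw [sum_comm]
    have e3 : ∀ h : Fin n → Bool, ∑ x, G y * G (bxor t h) * twist (bxor y h) x =
        G y * G (bxor t h) * (if bxor y h = zeroVec then (2 : ℝ) ^ n else 0) := by
      intro h
      rw [← mul_sum]
      congr 1
      exact sum_twist _
    rw [sum_congr rfl fun h _ => e3 h]
    simp_rw [bxor_eq_zeroVec_iff, mul_ite, mul_zero]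
    rw [Finset.sum_ite_eq univ y, if_pos (mem_univ _), bxor_comm t y]
    ring
  rw [sum_congr rfl fun x _ => e1 x, sum_comm, sum_congr rfl fun y _ => e2 y, ← mul_sum]

/-- **Near-exactness forces near-balanced derivatives, real form.** For `±1`-valued `F G : {0,1}ⁿ → ℝ`,
`c ≥ 0` with `c² = 2ⁿ`, and `Φ` with `Σ_x F(x) W_G(x) = 2ⁿ c Φ` (i.e. `Φ = 2^{-3n/2} S(F,G)`), every non-zero
shift `t` has `|Σ_y G(y) G(y ⊕ t)| ≤ 2ⁿ (2 √(2(1 − Φ)) + 2(1 − Φ))` (residual `R = W_G − cF`,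
`Σ R² = 2·4ⁿ(1 − Φ)`, Wiener–Khinchin, Cauchy–Schwarz). -/
theorem tb_autocorr_le_real (F G : (Fin n → Bool) → ℝ) (hF : ∀ x, F x ^ 2 = 1) (hG : ∀ y, G y ^ 2 = 1)
    (c Φ : ℝ) (hc0 : 0 ≤ c) (hc2 : c ^ 2 = (2 : ℝ) ^ n)
    (hΦ : ∑ x, F x * W G x = (2 : ℝ) ^ n * c * Φ) {t : Fin n → Bool} (ht : t ≠ zeroVec) :
    |∑ y, G y * G (bxor y t)| ≤ (2 : ℝ) ^ n * (2 * Real.sqrt (2 * (1 - Φ)) + 2 * (1 - Φ)) := by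
  have hN : (0 : ℝ) < 2 ^ n := by positivity
  have htw0 : ∑ x : Fin n → Bool, twist x t = 0 := by rw [sum_twist_left, if_neg ht]
  have hW2 : ∑ x, W G x ^ 2 = (2 : ℝ) ^ n * 2 ^ n := by
    rw [sum_W_sq]
    simp_rw [hG, sum_const, card_univ, Fintype.card_fun, Fintype.card_bool, Fintype.card_fin,
      nsmul_eq_mul, mul_one]
    push_cast
    rfl
  have hF2 : ∑ x : Fin n → Bool, F x ^ 2 = (2 : ℝ) ^ n := by
    simp_rw [hF, sum_const, card_univ, Fintype.card_fun, Fintype.card_bool, Fintype.card_fin,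
      nsmul_eq_mul, mul_one]
    push_cast
    rfl
  -- the residual `R = W_G - c F` and its mass
  set R : (Fin n → Bool) → ℝ := fun x => W G x - c * F x with hR
  have hR2 : ∑ x, R x ^ 2 = 2 * ((2 : ℝ) ^ n * 2 ^ n) * (1 - Φ) := by
    have e : ∀ x, R x ^ 2 = W G x ^ 2 - 2 * c * (F x * W G x) + c ^ 2 * F x ^ 2 := fun x => by
      simp only [hR]; ring
    simp_rw [e, sum_add_distrib, sum_sub_distrib, ← mul_sum, hW2, hΦ, hF2]
    linear_combination ((2 : ℝ) ^ n - 2 * 2 ^ n * Φ) * hc2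
  have hR0 : 0 ≤ ∑ x, R x ^ 2 := sum_nonneg fun x _ => sq_nonneg _
  have hε : 0 ≤ 1 - Φ := by
    have h2 : (0 : ℝ) < 2 * (2 ^ n * 2 ^ n) := by positivity
    rw [hR2] at hR0
    exact nonneg_of_mul_nonneg_right hR0 h2
  -- `2ⁿ AC(t) = 2c Σ F R χ_t + Σ R² χ_t`
  have hkey : (2 : ℝ) ^ n * ∑ y, G y * G (bxor y t) =
      2 * c * (∑ x, F x * twist x t * R x) + ∑ x, R x ^ 2 * twist x t := by
    rw [← tb_sum_W_sq_mul_twist G t]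
    have e : ∀ x, W G x ^ 2 * twist x t =
        c ^ 2 * (F x ^ 2 * twist x t) + 2 * c * (F x * twist x t * R x) + R x ^ 2 * twist x t := by
      intro x; simp only [hR]; ring
    rw [sum_congr rfl fun x _ => e x, sum_add_distrib, sum_add_distrib, ← mul_sum, ← mul_sum]
    simp_rw [hF, one_mul, htw0, mul_zero, zero_add]
  -- Cauchy–Schwarz for the cross term
  set s : ℝ := Real.sqrt (2 * (1 - Φ)) with hs
  have hs0 : 0 ≤ s := Real.sqrt_nonneg _
  have hs2 : s ^ 2 = 2 * (1 - Φ) := Real.sq_sqrt (by positivity)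
  have hA : |∑ x, F x * twist x t * R x| ≤ 2 ^ n * c * s := by
    refine abs_le_of_sq_le_sq ?_ (by positivity)
    calc (∑ x, F x * twist x t * R x) ^ 2 ≤ (∑ x, (F x * twist x t) ^ 2) * ∑ x, R x ^ 2 :=
          sum_mul_sq_le_sq_mul_sq _ _ _
      _ = (2 : ℝ) ^ n * ∑ x, R x ^ 2 := by
          congr 1
          simp_rw [mul_pow, hF, twist_sq, mul_one, sum_const, card_univ, Fintype.card_fun,
            Fintype.card_bool, Fintype.card_fin, nsmul_eq_mul, mul_one]
          push_cast
          rfl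
      _ = (2 ^ n * c * s) ^ 2 := by rw [hR2, mul_pow, mul_pow, hc2, hs2]; ring
  -- the square term
  have hB : |∑ x, R x ^ 2 * twist x t| ≤ ∑ x, R x ^ 2 := by
    refine (abs_sum_le_sum_abs _ _).trans (le_of_eq (sum_congr rfl fun x _ => ?_))
    rw [abs_mul, abs_of_nonneg (sq_nonneg (R x))]
    rcases twist_eq_one_or x t with h | h <;> simp [h]
  -- assemble and divide by `2ⁿ`
  have hfin : (2 : ℝ) ^ n * |∑ y, G y * G (bxor y t)| ≤ 2 ^ n * (2 ^ n * (2 * s + 2 * (1 - Φ))) := by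
    have habs : (2 : ℝ) ^ n * |∑ y, G y * G (bxor y t)| = |(2 : ℝ) ^ n * ∑ y, G y * G (bxor y t)| := by
      rw [abs_mul, abs_of_pos hN]
    rw [habs, hkey]
    calc |2 * c * (∑ x, F x * twist x t * R x) + ∑ x, R x ^ 2 * twist x t|
        ≤ |2 * c * ∑ x, F x * twist x t * R x| + |∑ x, R x ^ 2 * twist x t| := abs_add_le _ _
      _ = 2 * c * |∑ x, F x * twist x t * R x| + |∑ x, R x ^ 2 * twist x t| := by
          rw [abs_mul, abs_of_nonneg (by positivity : (0 : ℝ) ≤ 2 * c)]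
      _ ≤ 2 * c * (2 ^ n * c * s) + ∑ x, R x ^ 2 :=
          add_le_add (mul_le_mul_of_nonneg_left hA (by positivity)) hB
      _ = 2 ^ n * (2 ^ n * (2 * s + 2 * (1 - Φ))) := by
          rw [hR2]; linear_combination (2 * 2 ^ n * s) * hc2
  exact le_of_mul_le_mul_left hfin hN

/-- **stub tb_autocorr_le_of_forrelation** (NEAR-EXACTNESS FORCES NEAR-BALANCED DERIVATIVES): for Boolean
`f g : {0,1}ⁿ → {0,1}` and every shift `t ≠ 0`, the autocorrelation of `(−1)^g` at `t` is at most
`2ⁿ (2 √(2(1 − Φ(f,g))) + 2(1 − Φ(f,g)))` in absolute value (`tb_autocorr_le_real` with `F = (−1)^f`,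
`G = (−1)^g`, `c = √(2ⁿ)`, and `Σ_x F(x) W_G(x) = √(2^{3n}) Φ(f,g) = 2ⁿ √(2ⁿ) Φ(f,g)`). -/
theorem tb_autocorr_le_of_forrelation :
    ∀ (n : ℕ) (f g : (Fin n → Bool) → Bool) (t : Fin n → Bool), t ≠ zeroVec →
      |∑ y : Fin n → Bool, signOf (g y) * signOf (g (bxor y t))| ≤
        (2 : ℝ) ^ n * (2 * Real.sqrt (2 * (1 - forrelation f g)) + 2 * (1 - forrelation f g)) := by
  intro n f g t ht
  have hΦ := fsum_signOf_eq f g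
  rw [fsum_eq_sum_mul_W, sqrt_two_pow_three_mul] at hΦ
  exact tb_autocorr_le_real (fun x => signOf (f x)) (fun y => signOf (g y)) (fun x => signOf_sq (f x))
    (fun y => signOf_sq (g y)) _ _ (Real.sqrt_nonneg _) (Real.sq_sqrt (by positivity)) hΦ ht

end Summit.QuantumAdvantage.QuantumAdvantage.Theorems.CubicForrelation.NearExactIsExact

end
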